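import Literature.NumberTheory.GaloisRepresentations.TateLocalH2Nonvanishing
import Literature.NumberTheory.GaloisRepresentations.TateLocalH2Pigeonhole
import Literature.NumberTheory.GaloisRepresentations.TateH2VanishingCorestriction
import HarnessLib

/-!
# `H²(Γ_K, ℤ/p) ≠ 0` and `dim H²(Γ_K, ℤ/p) ≤ 1` for a local field `K ∋ ζ_p` — coefficients `ZMod p`

Topic `NumberTheory/GaloisRepresentations`; namespace `Literature.NumberTheory.GaloisRepresentations`.
Proof file: theorems only (no definition, no instance, no named fact).

`K` is a non-archimedean local field of characteristic `0` containing a primitive `p`-th root of unity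
(`p` prime), `Γ_K` its absolute Galois group.  The tree proves, in the explicit model "locally
constant `p`-torsion cochains `Γ_K × Γ_K → ℚ/ℤ`, trivial action":

* `exists_twoCocycle_not_pTorsionCoboundary_of_isPrimitiveRoot` — `H²(Γ_K, ℤ/p) ≠ 0` (Serre, Durham
  1977, §6.5 (b): "`Br_p(K) = ℤ/pℤ` … `δ` is non-zero");
* `twoCocycle_addCircle_pigeonhole_of_isPrimitiveRoot` — among `p + 1` classes two coincide
  (`|H²(Γ_K, μ_p)| = p`, Serre, *Corps locaux* XIII §3).

This file rewrites both with coefficients in the FIELD `ZMod p` (the convention of abc-iut-w5-d055's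
abstract Neukirch files `NeukirchAbstract*.lean`, where `R` is a field and no torsion side condition
is carried), through the embedding `ZMod p ↪ ℚ/ℤ`, `k ↦ k/p`, whose image is the `p`-torsion
(`zmod_exists_addMonoidHom_addCircle`):

* `exists_twoCocycle_zmod_not_coboundary_of_isPrimitiveRoot` — there is a locally constant
  `2`-cocycle `Γ_K × Γ_K → ZMod p` which is not the coboundary of any locally constant cochain;
* `twoCocycle_zmod_dim_le_one_of_isPrimitiveRoot` — if `f` is such a non-cobounding cocycle then every
  locally constant `2`-cocycle `g` is `c • f` plus a coboundary for some `c : ZMod p`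
  ("`dim_{𝔽_p} H²(Γ_K, ℤ/p) ≤ 1`"; from the pigeonhole applied to `f, g, g - f, …, g - (p-1) f`).

These are the "local type" inputs (AxLn)/(AxD) of Neukirch's characterisation of decomposition
groups ([NSW] (12.1.9)) at the absolute Galois group of a local field; their transport to
`D_𝔓 ∩ W ≤ Γ_F` (`F` a number field) is `DecompositionSubgroupLocalTypeCochains.lean`.

## References

* J.-P. Serre, *Modular forms of weight one and Galois representations* (Durham 1977), §6.5 (b).
  [SerreDurham1977]
* J.-P. Serre, *Local Fields* (1979), XIII §3. [SerreLocalFields1979]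
* J. Neukirch, A. Schmidt, K. Wingberg, *Cohomology of Number Fields* (2008), (12.1.9).
  [NeukirchSchmidtWingberg2008]
-/

noncomputable section

open Function Field

namespace Literature.NumberTheory.GaloisRepresentations

section Local

variable (F : Type) [Field F] [ValuativeRel F] [TopologicalSpace F] [IsNonarchimedeanLocalField F]
  [CharZero F]

/-- **`H²(Γ_K, ℤ/p) ≠ 0` for a local field `K ∋ ζ_p`, coefficients `ZMod p`.**  If `ζ ∈ K` is a
primitive `p`-th root of unity (`p` prime) there is a locally constant `2`-cocycle
`d : Γ_K × Γ_K → ZMod p` (trivial action) which is not the coboundary `(σ, τ) ↦ β σ + β τ - β (σ τ)`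
of any locally constant `β : Γ_K → ZMod p` — the `ℚ/ℤ`-valued `p`-torsion class of
`exists_twoCocycle_not_pTorsionCoboundary_of_isPrimitiveRoot` (Serre, Durham 1977, §6.5 (b)) read
through `ZMod p ≅ (1/p)ℤ/ℤ ⊆ ℚ/ℤ`. [cite: SerreDurham1977, §6.5 (b)] -/
theorem exists_twoCocycle_zmod_not_coboundary_of_isPrimitiveRoot {p : ℕ} (hp : p.Prime) {ζ : F}
    (hζ : IsPrimitiveRoot ζ p) :
    ∃ d : absoluteGaloisGroup F → absoluteGaloisGroup F → ZMod p,
      IsLocallyConstant (Function.uncurry d) ∧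
      (∀ σ τ υ, d σ τ + d (σ * τ) υ = d τ υ + d σ (τ * υ)) ∧
      ∀ β : absoluteGaloisGroup F → ZMod p, IsLocallyConstant β →
        ¬ ∀ σ τ, d σ τ = β σ + β τ - β (σ * τ) := by
  classical
  obtain ⟨d₀, hlc, hcoc, hptor, hncob⟩ :=
    exists_twoCocycle_not_pTorsionCoboundary_of_isPrimitiveRoot F hp hζ
  obtain ⟨e, he_inj, -, he_surj⟩ := zmod_exists_addMonoidHom_addCircle hp.pos
  -- `g` = a set-theoretic inverse of `e` on its image (the `p`-torsion)
  let g : AddCircle (1 : ℚ) → ZMod p := Function.invFun e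
  have hge : ∀ x : AddCircle (1 : ℚ), p • x = 0 → e (g x) = x := fun x hx =>
    Function.invFun_eq (he_surj x hx)
  -- `d = e⁻¹ ∘ d₀`
  refine ⟨fun σ τ => g (d₀ σ τ), hlc.comp g, fun σ τ υ => he_inj ?_, fun β hβ hcob => ?_⟩
  · rw [map_add, map_add, hge _ (hptor σ τ), hge _ (hptor _ _), hge _ (hptor _ _),
      hge _ (hptor _ _)]
    exact hcoc σ τ υ
  · -- `d₀ = e ∘ d = ∂ (e ∘ β)`, a `p`-torsion locally constant coboundary: contradiction
    refine hncob (fun σ => e (β σ)) (hβ.comp e) (fun σ => ?_) (fun σ τ => ?_)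
    · rw [← map_nsmul, nsmul_eq_mul, ZMod.natCast_self, zero_mul, map_zero]
    · have h1 : g (d₀ σ τ) = β σ + β τ - β (σ * τ) := hcob σ τ
      rw [← hge _ (hptor σ τ), h1, map_sub, map_add]

/-- **`dim H²(Γ_K, ℤ/p) ≤ 1` for a local field `K ∋ ζ_p`, coefficients `ZMod p`** (cochain form of
`|H²(Γ_K, μ_p)| = p`, Serre *Local Fields* XIII §3; [NSW] (7.1.8)): if `f` is a locally constant
`2`-cocycle `Γ_K × Γ_K → ZMod p` which is NOT a coboundary, then every locally constant `2`-cocycle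
`g` differs from some multiple `c • f` (`c : ZMod p`) by the coboundary of a locally constant
cochain.  Proof: apply the pigeonhole `twoCocycle_addCircle_pigeonhole_of_isPrimitiveRoot` to the
`p + 1` cocycles `g - i • f` (`i < p`) and `f` (read in `ℚ/ℤ` via `k ↦ k/p`); a coincidence between
two of the first kind forces `f` to bound (excluded), any other coincidence is the claim.
[cite: SerreLocalFields1979, XIII §3] -/
theorem twoCocycle_zmod_dim_le_one_of_isPrimitiveRoot {p : ℕ} (hp : p.Prime) {ζ : F}
    (hζ : IsPrimitiveRoot ζ p)
    (f g : absoluteGaloisGroup F → absoluteGaloisGroup F → ZMod p)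
    (hflc : IsLocallyConstant (Function.uncurry f))
    (hfcoc : ∀ σ τ υ, f σ τ + f (σ * τ) υ = f τ υ + f σ (τ * υ))
    (hglc : IsLocallyConstant (Function.uncurry g))
    (hgcoc : ∀ σ τ υ, g σ τ + g (σ * τ) υ = g τ υ + g σ (τ * υ))
    (hf : ∀ β : absoluteGaloisGroup F → ZMod p, IsLocallyConstant β →
      ¬ ∀ σ τ, f σ τ = β σ + β τ - β (σ * τ)) :
    ∃ (c : ZMod p) (β : absoluteGaloisGroup F → ZMod p), IsLocallyConstant β ∧
      ∀ σ τ, g σ τ - c * f σ τ = β σ + β τ - β (σ * τ) := by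
  classical
  haveI : Fact p.Prime := ⟨hp⟩
  obtain ⟨e, he_inj, -, he_surj⟩ := zmod_exists_addMonoidHom_addCircle hp.pos
  let ginv : AddCircle (1 : ℚ) → ZMod p := Function.invFun e
  have hge : ∀ x : AddCircle (1 : ℚ), p • x = 0 → e (ginv x) = x := fun x hx =>
    Function.invFun_eq (he_surj x hx)
  have hpe : ∀ k : ZMod p, p • e k = 0 := fun k => by
    rw [← map_nsmul, nsmul_eq_mul, ZMod.natCast_self, zero_mul, map_zero]
  -- the `p + 1` cochains `h i = g - i • f` (`i < p`) and `h p = f`, with coefficients `ZMod p`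
  let h : Fin (p + 1) → absoluteGaloisGroup F → absoluteGaloisGroup F → ZMod p := fun i σ τ =>
    if (i : ℕ) < p then g σ τ - ((i : ℕ) : ZMod p) * f σ τ else f σ τ
  have hlast : ∀ i : Fin (p + 1), ¬ (i : ℕ) < p → (i : ℕ) = p := fun i hi => by omega
  have hh_lt : ∀ i : Fin (p + 1), (i : ℕ) < p →
      h i = fun σ τ => g σ τ - ((i : ℕ) : ZMod p) * f σ τ := fun i hi => by
    funext σ τ; simp only [h, if_pos hi]
  have hh_p : ∀ i : Fin (p + 1), ¬ (i : ℕ) < p → h i = f := fun i hi => by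
    funext σ τ; simp only [h, if_neg hi]
  have hhlc : ∀ i, IsLocallyConstant (Function.uncurry (h i)) := by
    intro i
    by_cases hi : (i : ℕ) < p
    · rw [hh_lt i hi]
      exact hglc.comp₂ hflc (fun x y => x - ((i : ℕ) : ZMod p) * y)
    · rw [hh_p i hi]; exact hflc
  have hhcoc : ∀ i σ τ υ, h i σ τ + h i (σ * τ) υ = h i τ υ + h i σ (τ * υ) := by
    intro i σ τ υ
    by_cases hi : (i : ℕ) < p
    · rw [hh_lt i hi]
      linear_combination hgcoc σ τ υ - ((i : ℕ) : ZMod p) * hfcoc σ τ υ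
    · rw [hh_p i hi]; exact hfcoc σ τ υ
  -- read in `ℚ/ℤ` and apply the pigeonhole
  obtain ⟨i, j, hij, β₀, hβ₀lc, hβ₀p, hβ₀⟩ :=
    twoCocycle_addCircle_pigeonhole_of_isPrimitiveRoot F hp hζ (fun i σ τ => e (h i σ τ))
      (fun i => (hhlc i).comp e) (fun i σ τ υ => by
        rw [← map_add, ← map_add, hhcoc i σ τ υ]) (fun i σ τ => hpe _)
  -- back to `ZMod p`: `h i - h j = ∂ β` with `β = e⁻¹ ∘ β₀`
  let β : absoluteGaloisGroup F → ZMod p := fun σ => ginv (β₀ σ)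
  have hβlc : IsLocallyConstant β := hβ₀lc.comp ginv
  have hβe : ∀ σ, e (β σ) = β₀ σ := fun σ => hge _ (hβ₀p σ)
  have hdiff : ∀ σ τ, h i σ τ - h j σ τ = β σ + β τ - β (σ * τ) := fun σ τ => he_inj (by
    rw [map_sub, map_sub, map_add, hβe, hβe, hβe]; exact hβ₀ σ τ)
  -- case analysis on which of `i`, `j` is the extra index `p`
  by_cases hi : (i : ℕ) < p <;> by_cases hj : (j : ℕ) < p
  · -- both `< p`: `(j - i) • f = ∂β` with `j ≠ i` in `ZMod p`, so `f` bounds — excluded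
    exfalso
    have hij' : ((j : ℕ) : ZMod p) - ((i : ℕ) : ZMod p) ≠ 0 := by
      intro h0
      apply hij
      apply Fin.ext
      have h1 : ((j : ℕ) : ZMod p) = ((i : ℕ) : ZMod p) := sub_eq_zero.mp h0
      rw [ZMod.natCast_eq_natCast_iff'] at h1
      rw [Nat.mod_eq_of_lt hj, Nat.mod_eq_of_lt hi] at h1
      exact h1.symm
    have hunit : IsUnit (((j : ℕ) : ZMod p) - ((i : ℕ) : ZMod p)) := isUnit_iff_ne_zero.mpr hij'
    obtain ⟨u, hu⟩ := hunit.exists_left_inv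
    refine hf (fun σ => u * β σ) (hβlc.comp (fun x => u * x)) (fun σ τ => ?_)
    have hd := hdiff σ τ
    rw [hh_lt i hi, hh_lt j hj] at hd
    -- `hd : (g - i f) - (g - j f) = ∂β`, i.e. `(j - i) f = ∂β`
    have h2 : (((j : ℕ) : ZMod p) - ((i : ℕ) : ZMod p)) * f σ τ = β σ + β τ - β (σ * τ) := by
      rw [← hd]; ring
    calc f σ τ = u * ((((j : ℕ) : ZMod p) - ((i : ℕ) : ZMod p)) * f σ τ) := by
            rw [← mul_assoc, hu, one_mul]
      _ = u * β σ + u * β τ - u * β (σ * τ) := by rw [h2]; ring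
  · -- `i < p`, `j = p`: `(g - i f) - f = ∂β`
    refine ⟨((i : ℕ) : ZMod p) + 1, β, hβlc, fun σ τ => ?_⟩
    have hd := hdiff σ τ
    rw [hh_lt i hi, hh_p j hj] at hd
    rw [← hd]; ring
  · -- `i = p`, `j < p`: `f - (g - j f) = ∂β`
    refine ⟨((j : ℕ) : ZMod p) + 1, fun σ => -β σ, hβlc.neg, fun σ τ => ?_⟩
    have hd := hdiff σ τ
    rw [hh_p i hi, hh_lt j hj] at hd
    have hd' : g σ τ - (((j : ℕ) : ZMod p) + 1) * f σ τ = -(β σ + β τ - β (σ * τ)) := by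
      rw [← hd]; ring
    rw [hd']; ring
  · -- both `= p`: impossible since `i ≠ j`
    exfalso
    exact hij (Fin.ext ((hlast i hi).trans (hlast j hj).symm))

end Local

end Literature.NumberTheory.GaloisRepresentations

end
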